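import Summits.QuantumFields.YangMills.Theorems.SwapVirialDeficitBlowUpFollowerChart
import Summits.QuantumFields.YangMills.Theorems.SwapVirialDeficitGnomonicDilation
import Literature.MathematicalPhysics.KineticTheory.HardSphereEulerProofs
import HarnessLib

/-!
# The FOLLOWER CHART in GNOMONIC coordinates (brick G1-F of fcl-p3 g45's virial SPEC, memo 2 v2 §2′): `Haar^ι` as `(2π²)^{−|ι|} Σ_{ε ∈ {±}^ι}`
# `∏_i (1+|η_i|²)⁻² dη` through the letters `U_i = quatToSU2 (±(1, η_i))` — NO side condition
# (free-hands support of ⟨stmt-QuantumFields-24197⟩ `SwapVirialDeficit.SwapGluedStiffness`)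

fcl-p3 g45's SPEC (ym-idea-1 STATUS 13:18:22Z): the virial identity lives in the GNOMONIC chart of `SU(2)` (✓`Literature…lintegral_haarProbability_su2_gnomonic`:
`∫ F dHaar = (2π²)⁻¹ ∫_{ℝ³} [F(P(1, v)) + F(P(−1, −v))] (1+|v|²)⁻² dv`), where the blow-up is a linear dilation and no ball condition cuts the chart.  The follower
half of the ring chart needs the PRODUCT version over the follower index `ι` (`ι := BlowUpRing.Fol L`); this file proves it, GENERIC in a finite `ι`:

* §2 `isFiniteMeasure_gnoMeasure` (mass `π²`, ✓`Gnomonic.lintegral_gnomonicWeight`), and ★★ `haar_eq_gnomonic_sum` — Haar on `SU(2)` as a MEASURE: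
  `(2π²)⁻¹ · Σ_{b ∈ Bool} map_{v ↦ quatToSU2((±1)·(1,v))} ((1+|v|²)⁻² dv)` (the chart formula on indicators);
* §3 ★★ `pi_haar_eq_gnomonic_sum` — `Haar^ι = (2π²)^{−|ι|} · Σ_{ε ∈ Bool^ι} ⊗_i map_{ε_i}((1+|v|²)⁻² dv)` (`Measure.pi_eq`, `Fintype.prod_sum`);
  ★ `pi_gnoMeasure_eq_withDensity` — `⊗_i ((1+|v|²)⁻² dv) = (∏_i (1+|η_i|²)⁻²) dη` on `(ℝ³)^ι` (✓`KineticTheory.pi_withDensity_eq`, whose `PiLemmas`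
  section also has the `lintegral` Tonelli `lintegral_fintype_prod_eq_prod'`);
* §4 ★★★ `lintegral_haar_pi_eq_gnomonic` — for every measurable `f ≥ 0` on `SU(2)^ι`:
  `∫⁻ f dHaar^ι = (2π²)^{−|ι|} · Σ_{ε ∈ Bool^ι} ∫⁻ f (i ↦ quatToSU2 ((if ε i then 1 else −1) • gnomonicQuat (η i))) · ∏_i (1+|η_i|²)⁻² dη`
  (`Measure.pi_map_pi`, `lintegral_map`, `lintegral_withDensity_eq_lintegral_mul`).  The letter `(if ε then 1 else −1) • gnomonicQuat v` is fcl-p3 g45's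
  `gnoLetter ε v` (G0) verbatim; the weight `∏_i (1+|η_i|²)⁻²` is `ofReal (Gnomonic.piWeight η)` of ✓`…GnomonicDilation` factorwise.

HONEST LABEL: measure-theoretic chart plumbing for the window programme of a DRAFT line; no statement about the ring; ⟨24197⟩ (window-uniform) ∕ ⟨24194⟩ ∕ ⟨24497⟩
OPEN; own crux ⟨22884⟩ OPEN (blocked-on ⟨19935⟩); no crux, rung of record or summit is proved; the Yang–Mills mass gap is NOT proved; no summit is proved by a line.
THEOREMS ONLY (0 `def`, 0 `sorry`), standard axioms; the series' local `ℍ` instances.  Width seat ym-line-sfw-p2-w2 g57 (cell ym-idea-1, free hands),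
`--supports stmt-QuantumFields-24197`.  References: [cite: Chatterjee2026YMHiggs, Lemma 5.1 and Cor. 5.2 (Haar on SU(2) in coordinates)]; [folklore].
-/

set_option autoImplicit false

noncomputable section

open MeasureTheory Quaternion Set
open scoped Quaternion ENNReal BigOperators
open Literature.MathematicalPhysics.QuantumLattice
open Literature.MathematicalPhysics.QuantumFieldTheory (haarProbability)

attribute [local instance] Literature.Analysis.FluidPDE.Tao2016.quatMeasurableSpace
  Literature.Analysis.FluidPDE.Tao2016.quatBorelSpace
  Literature.MathematicalPhysics.QuantumLattice.secondCountableTopology_su2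

namespace Summit.QuantumFields.YangMills.Theorems.SwapVirialDeficit.BlowUpRing

variable {ι : Type*} [Fintype ι] [DecidableEq ι]

/-! ## §2 One letter: Haar on `SU(2)` as a MEASURE in the gnomonic chart -/

/-- The gnomonic weight `(1+|v|²)⁻²` as an `ℝ≥0∞`-valued function is measurable. [folklore] -/
theorem measurable_gnoWeightENN : Measurable fun v : Fin 3 → ℝ => ENNReal.ofReal (((1 + ∑ j, v j ^ 2)⁻¹) ^ 2) := by
  refine ENNReal.measurable_ofReal.comp ?_
  have h : Continuous fun v : Fin 3 → ℝ => ∑ j, v j ^ 2 := by fun_prop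
  have h1 : Continuous fun v : Fin 3 → ℝ => 1 + ∑ j, v j ^ 2 := continuous_const.add h
  refine ((h1.inv₀ fun v => ?_).pow 2).measurable
  have : 0 ≤ ∑ j, v j ^ 2 := Finset.sum_nonneg fun j _ => sq_nonneg (v j)
  exact ne_of_gt (by linarith)

/-- The signed gnomonic letter map `v ↦ quatToSU2 (±(1, v))` is measurable. [folklore] -/
theorem measurable_gnoLetterSU2 (c : ℝ) : Measurable fun v : Fin 3 → ℝ => quatToSU2 (c • gnomonicQuat v) :=
  measurable_quatToSU2.comp (measurable_gnomonicQuat.const_smul c)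

/-- The weighted Lebesgue measure `(1+|v|²)⁻² dv` on `ℝ³` is finite (mass `π²`). [folklore] -/
theorem isFiniteMeasure_gnoMeasure :
    IsFiniteMeasure ((volume : Measure (Fin 3 → ℝ)).withDensity fun v => ENNReal.ofReal (((1 + ∑ j, v j ^ 2)⁻¹) ^ 2)) := by
  refine isFiniteMeasure_withDensity ?_
  have h : ∫⁻ v : Fin 3 → ℝ, ENNReal.ofReal (((1 + ∑ j, v j ^ 2)⁻¹) ^ 2) = ENNReal.ofReal (Real.pi ^ 2) := Gnomonic.lintegral_gnomonicWeight
  rw [h]; exact ENNReal.ofReal_ne_top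

/-- ★★ **HAAR ON `SU(2)` AS A MEASURE IN THE GNOMONIC CHART**: `Haar = (2π²)⁻¹ · Σ_{b = ±} (map of (1+|v|²)⁻² dv under v ↦ quatToSU2 (b·(1, v)))`
(✓`lintegral_haarProbability_su2_gnomonic` on indicators). [cite: Chatterjee2026YMHiggs, Lemma 5.1 and Cor. 5.2 (Haar on SU(2) in coordinates)] -/
theorem haar_eq_gnomonic_sum :
    haarProbability (Matrix.specialUnitaryGroup (Fin 2) ℂ) = ENNReal.ofReal (1 / (2 * Real.pi ^ 2)) •
      ∑ b : Bool, ((volume : Measure (Fin 3 → ℝ)).withDensity fun v => ENNReal.ofReal (((1 + ∑ j, v j ^ 2)⁻¹) ^ 2)).map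
        (fun v => quatToSU2 ((if b then (1 : ℝ) else -1) • gnomonicQuat v)) := by
  ext A hA
  have h := lintegral_haarProbability_su2_gnomonic (A.indicator 1) (measurable_one.indicator hA)
  rw [lintegral_indicator_one hA] at h
  rw [h, Measure.smul_apply, smul_eq_mul, Measure.coe_finsetSum, Finset.sum_apply, Fintype.sum_bool,
    Measure.map_apply (measurable_gnoLetterSU2 _) hA, Measure.map_apply (measurable_gnoLetterSU2 _) hA,
    withDensity_apply _ (hA.preimage (measurable_gnoLetterSU2 _)), withDensity_apply _ (hA.preimage (measurable_gnoLetterSU2 _)),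
    ← lintegral_indicator (hA.preimage (measurable_gnoLetterSU2 _)), ← lintegral_indicator (hA.preimage (measurable_gnoLetterSU2 _)),
    ← lintegral_add_left ((measurable_gnoWeightENN).indicator (hA.preimage (measurable_gnoLetterSU2 _)))]
  congr 1
  refine lintegral_congr fun v => ?_
  simp only [one_smul, neg_one_smul, if_true, Bool.false_eq_true, if_false]
  by_cases h1 : quatToSU2 (gnomonicQuat v) ∈ A
  · by_cases h2 : quatToSU2 (-gnomonicQuat v) ∈ A
    · simp [Set.indicator_of_mem, h1, h2]; ring
    · simp [Set.indicator_of_mem, Set.indicator_of_notMem, h1, h2]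
  · by_cases h2 : quatToSU2 (-gnomonicQuat v) ∈ A
    · simp [Set.indicator_of_mem, Set.indicator_of_notMem, h1, h2]
    · simp [Set.indicator_of_notMem, h1, h2]

/-! ## §3 The product: signs `ε ∈ {±}^ι` and the weighted Lebesgue measure on `(ℝ³)^ι` -/

/-- `∏_i` of scaled measures: `⊗_i (c • m_i) = c^{|ι|} • ⊗_i m_i`-type bookkeeping on boxes together with additivity — ★ **`Haar^ι` decomposed**:
`Haar^ι = (2π²)^{−|ι|} · Σ_{ε ∈ {±}^ι} ⊗_i (map of the weighted measure under the letter `ε_i`)`. [folklore] -/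
theorem pi_haar_eq_gnomonic_sum :
    Measure.pi (fun _ : ι => haarProbability (Matrix.specialUnitaryGroup (Fin 2) ℂ)) =
      ENNReal.ofReal (1 / (2 * Real.pi ^ 2)) ^ Fintype.card ι •
        ∑ ε : ι → Bool, Measure.pi fun i => ((volume : Measure (Fin 3 → ℝ)).withDensity fun v => ENNReal.ofReal (((1 + ∑ j, v j ^ 2)⁻¹) ^ 2)).map
          (fun v => quatToSU2 ((if ε i then (1 : ℝ) else -1) • gnomonicQuat v)) := by
  haveI := isFiniteMeasure_gnoMeasure
  refine Measure.pi_eq fun s hs => ?_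
  rw [Measure.smul_apply, smul_eq_mul, Measure.coe_finsetSum, Finset.sum_apply]
  have hpi : ∀ ε : ι → Bool, (Measure.pi fun i => ((volume : Measure (Fin 3 → ℝ)).withDensity fun v => ENNReal.ofReal (((1 + ∑ j, v j ^ 2)⁻¹) ^ 2)).map
      (fun v => quatToSU2 ((if ε i then (1 : ℝ) else -1) • gnomonicQuat v))) (Set.univ.pi s) =
      ∏ i, (((volume : Measure (Fin 3 → ℝ)).withDensity fun v => ENNReal.ofReal (((1 + ∑ j, v j ^ 2)⁻¹) ^ 2)).map
        (fun v => quatToSU2 ((if ε i then (1 : ℝ) else -1) • gnomonicQuat v))) (s i) := fun ε => Measure.pi_pi _ s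
  simp only [hpi]
  rw [← Fintype.prod_sum (fun (i : ι) (b : Bool) => (((volume : Measure (Fin 3 → ℝ)).withDensity fun v => ENNReal.ofReal (((1 + ∑ j, v j ^ 2)⁻¹) ^ 2)).map
    (fun v => quatToSU2 ((if b then (1 : ℝ) else -1) • gnomonicQuat v))) (s i))]
  have h1 : ∀ i, haarProbability (Matrix.specialUnitaryGroup (Fin 2) ℂ) (s i) = ENNReal.ofReal (1 / (2 * Real.pi ^ 2)) *
      ∑ b : Bool, (((volume : Measure (Fin 3 → ℝ)).withDensity fun v => ENNReal.ofReal (((1 + ∑ j, v j ^ 2)⁻¹) ^ 2)).map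
        (fun v => quatToSU2 ((if b then (1 : ℝ) else -1) • gnomonicQuat v))) (s i) := by
    intro i
    rw [haar_eq_gnomonic_sum, Measure.smul_apply, smul_eq_mul, Measure.coe_finsetSum, Finset.sum_apply]
  simp only [h1]
  rw [Finset.prod_mul_distrib, Finset.prod_const, Finset.card_univ]

omit [DecidableEq ι] in
/-- ★ **`⊗_i (w dv) = (∏_i w(η_i)) dη`** (✓`KineticTheory.pi_withDensity_eq`). [folklore] -/
theorem pi_gnoMeasure_eq_withDensity :
    Measure.pi (fun _ : ι => (volume : Measure (Fin 3 → ℝ)).withDensity fun v => ENNReal.ofReal (((1 + ∑ j, v j ^ 2)⁻¹) ^ 2)) =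
      (Measure.pi fun _ : ι => (volume : Measure (Fin 3 → ℝ))).withDensity
        fun η => ∏ i, ENNReal.ofReal (((1 + ∑ j, η i j ^ 2)⁻¹) ^ 2) := by
  haveI := isFiniteMeasure_gnoMeasure
  exact Literature.MathematicalPhysics.KineticTheory.pi_withDensity_eq (fun _ : ι => (volume : Measure (Fin 3 → ℝ)))
    (fun _ => measurable_gnoWeightENN) fun _ => inferInstance

/-! ## §4 The follower chart in gnomonic coordinates -/

/-- ★★★ **`Haar^ι` IN THE PRODUCT GNOMONIC CHART**: for every measurable `f ≥ 0` on `SU(2)^ι`,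
`∫⁻ f dHaar^ι = (2π²)^{−|ι|} · Σ_{ε ∈ {±}^ι} ∫⁻ f (i ↦ quatToSU2 (ε_i·(1, η_i))) · ∏_i (1+|η_i|²)⁻² dη` over `(ℝ³)^ι` — NO side condition
(the cone chart ✓`lintegral_haar_pi_eq_followerChart` has the unit-ball condition instead); the brick G1-F of the virial SPEC with
`gnoLetter ε v = (if ε then 1 else −1) • gnomonicQuat v`. [cite: Chatterjee2026YMHiggs, Lemma 5.1 and Cor. 5.2 (Haar on SU(2) in coordinates)] -/
theorem lintegral_haar_pi_eq_gnomonic (f : (ι → Matrix.specialUnitaryGroup (Fin 2) ℂ) → ℝ≥0∞) (hf : Measurable f) :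
    ∫⁻ U, f U ∂(Measure.pi fun _ : ι => haarProbability (Matrix.specialUnitaryGroup (Fin 2) ℂ)) =
      ENNReal.ofReal (1 / (2 * Real.pi ^ 2)) ^ Fintype.card ι *
        ∑ ε : ι → Bool, ∫⁻ η : ι → Fin 3 → ℝ, f (fun i => quatToSU2 ((if ε i then (1 : ℝ) else -1) • gnomonicQuat (η i))) *
          ∏ i, ENNReal.ofReal (((1 + ∑ j, η i j ^ 2)⁻¹) ^ 2) ∂(Measure.pi fun _ : ι => (volume : Measure (Fin 3 → ℝ))) := by
  haveI := isFiniteMeasure_gnoMeasure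
  rw [pi_haar_eq_gnomonic_sum, lintegral_smul_measure, smul_eq_mul, lintegral_finsetSum_measure]
  congr 1
  refine Finset.sum_congr rfl fun ε _ => ?_
  have hφ : ∀ i : ι, Measurable fun v : Fin 3 → ℝ => quatToSU2 ((if ε i then (1 : ℝ) else -1) • gnomonicQuat v) := fun i => measurable_gnoLetterSU2 _
  have hΦ : Measurable fun (η : ι → Fin 3 → ℝ) (i : ι) => quatToSU2 ((if ε i then (1 : ℝ) else -1) • gnomonicQuat (η i)) :=
    measurable_pi_lambda _ fun i => (hφ i).comp (measurable_pi_apply i)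
  have hpm := Measure.pi_map_pi (μ := fun _ : ι => (volume : Measure (Fin 3 → ℝ)).withDensity fun v => ENNReal.ofReal (((1 + ∑ j, v j ^ 2)⁻¹) ^ 2))
    (f := fun i v => quatToSU2 ((if ε i then (1 : ℝ) else -1) • gnomonicQuat v)) fun i => (hφ i).aemeasurable
  have hWm : Measurable fun η : ι → Fin 3 → ℝ => ∏ i, ENNReal.ofReal (((1 + ∑ j, η i j ^ 2)⁻¹) ^ 2) :=
    Finset.measurable_prod _ fun i _ => measurable_gnoWeightENN.comp (measurable_pi_apply i)
  have hfm : Measurable fun η : ι → Fin 3 → ℝ => f (fun i => quatToSU2 ((if ε i then (1 : ℝ) else -1) • gnomonicQuat (η i))) := hf.comp hΦ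
  rw [← hpm, lintegral_map hf hΦ, pi_gnoMeasure_eq_withDensity, lintegral_withDensity_eq_lintegral_mul _ hWm hfm]
  refine lintegral_congr fun η => ?_
  simp only [Pi.mul_apply]
  rw [mul_comm]

end Summit.QuantumFields.YangMills.Theorems.SwapVirialDeficit.BlowUpRing

end
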